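import Mathlib
import Literature.NumberTheory.Automorphic.TunnellCubicLiftsOfLemma
import Literature.NumberTheory.Automorphic.TunnellOctahedralGlobalProofs
import HarnessLib

/-!
# The quadratic Hecke character of an open subgroup of index `≤ 2` (helper for item stmt-Langlands-13759)

For an open subgroup `H ≤ Γ_ℚ` of index `1` or `2` there is a finite-order Hecke character `ω` of `ℚ`
with `ω(ϖ_v) = +1` or `-1` according as the Frobenius at `v` lies in `H`, for almost all `v`
(`exists_heckeCharacter_of_index_le_two`): `ω = 1`, resp. the quadratic character of `ℚ̄^H` through
the Frobenius dictionary `exists_quadratic_frob_mem_iff` (a verbatim copy of the lemma of the same name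
of `IrreducibilityBySelfDualityEssSelfDualIrreducibleCMQuadratic`, item stmt-Langlands-13618, kept here
so that this file only imports `Literature`) and `exists_heckeCharacter_quadraticSign_of_finrank_eq_two`.
-/

set_option linter.dupNamespace false -- project-wide option (lakefile weak.linter.dupNamespace); `Summit.Langlands.Langlands` is the mandated namespace

noncomputable section

open scoped NumberField
open NumberField Field IsDedekindDomain Literature.NumberTheory.GaloisRepresentations

namespace Summit.Langlands.Langlands.Theorems.ResidualAutomorphyOdd

/-! ### The quadratic character `ω` -/

section Omega

open scoped Classical
open Filter Literature.NumberTheory.Automorphic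

/-- **The quadratic extension cut out by an open subgroup of index `2` and its Frobenius
dictionary** (verbatim copy of `Summit.Langlands.Langlands.Theorems.EssSelfDualIrreducibleCM.
exists_quadratic_frob_mem_iff`, item stmt-Langlands-13618, reproduced here to keep this file's
imports inside `Literature`): for a number field `K` and an open subgroup `H ≤ Γ_K` of index `2`
there is a quadratic number field `L ⊇ K` (`L = K̄^H`) such that at almost every finite place `v` of
`K`, every arithmetic Frobenius `Φ` above `v` lies in `H` iff some place of `L` above `v` has residue
degree `1`.  Neukirch, *Algebraic Number Theory*, I (9.3)–(9.5). [folklore] -/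
theorem exists_quadratic_frob_mem_iff (K : Type) [Field K] [NumberField K]
    (H : Subgroup (absoluteGaloisGroup K)) (hHo : IsOpen (H : Set (absoluteGaloisGroup K)))
    (hH2 : H.index = 2) :
    ∃ (L : Type) (_ : Field L) (_ : NumberField L) (_ : Algebra K L), Module.finrank K L = 2 ∧
      ∀ᶠ v : HeightOneSpectrum (𝓞 K) in cofinite, ∀ 𝔓 ∈ v.primesAbove,
        ∀ Φ : absoluteGaloisGroup K, IsArithFrobAt (𝓞 K) Φ 𝔓 →
          (Φ ∈ H ↔ ∃ w : HeightOneSpectrum (𝓞 L), w.asIdeal.under (𝓞 K) = v.asIdeal ∧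
            w.asIdeal.inertiaDeg (𝓞 K) = 1) := by
  classical
  -- the fixed field `L = K̄^H`, a quadratic (hence Galois) number field over `K`
  set L : IntermediateField K (AlgebraicClosure K) := IntermediateField.fixedField H with hLdef
  haveI hfd : FiniteDimensional K L := finiteDimensional_fixedField_of_isOpen H hHo
  have h2 : Module.finrank K L = 2 := (finrank_fixedField_of_isOpen H hHo).trans hH2
  haveI : NumberField L := NumberField.of_module_finite K L
  haveI : Algebra.IsQuadraticExtension K L := ⟨h2⟩
  haveI : IsGalois K L := inferInstance
  have hprime : (Module.finrank K L).Prime := by rw [h2]; exact Nat.prime_two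
  haveI hHn : H.Normal := Subgroup.normal_of_index_eq_two hH2
  -- `Gal(K̄/L) = H` inside `Γ_K`
  set r := absGaloisRestrict K L with hr
  have hrange : ∀ γ, γ ∈ r.range ↔ γ ∈ H := by
    obtain ⟨g, hg⟩ := exists_mem_range_absGaloisRestrict_fixedField_iff H hHo
    intro γ
    rw [hr, hLdef, hg γ]
    constructor
    · intro h
      have := hHn.conj_mem _ h g
      rwa [← mul_assoc, ← mul_assoc, mul_inv_cancel, one_mul, mul_assoc, mul_inv_cancel, mul_one] at this
    · intro h
      have := hHn.conj_mem _ h g⁻¹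
      rwa [inv_inv] at this
  have hrangeH : r.range = H := Subgroup.ext hrange
  have hHi : r.range.index = Module.finrank K L := by rw [hrangeH, hH2, h2]
  have hrn : r.range.Normal := by rw [hrangeH]; exact hHn
  -- the rank-one representation with kernel `H`, unramified almost everywhere
  let θ₀ : absoluteGaloisGroup K →* ℂˣ := signCharOfIndexTwo H hH2
  have hθ₀ker : (θ₀.ker : Set (absoluteGaloisGroup K)) = H := by
    rw [ker_signCharOfIndexTwo]
  have hθ₀cont : Continuous θ₀ :=
    MonoidHom.continuous_of_isOpen_ker θ₀ (by rw [hθ₀ker]; exact hHo)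
  let θ : absoluteGaloisGroup K →ₜ* ℂˣ := ⟨θ₀, hθ₀cont⟩
  let ψ : FramedGaloisRep K ℂ 1 :=
    ContinuousMonoidHom.comp
      (FramedRep.unitsContinuousMulEquivOfUnique (Fin 1) ℂ : ℂˣ →ₜ* GL (Fin 1) ℂ) θ
  have hψ : ∀ g (i j : Fin 1),
      ((ψ g : GL (Fin 1) ℂ) : Matrix (Fin 1) (Fin 1) ℂ) i j = (θ₀ g : ℂ) := fun g i j => rfl
  have hψ1 : ∀ g, ψ g = 1 ↔ g ∈ H := by
    intro g
    constructor
    · intro h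
      by_contra hg
      have h1 := congr_fun (congr_fun (congrArg (fun x : GL (Fin 1) ℂ => (x : Matrix (Fin 1) (Fin 1) ℂ)) h) 0) 0
      rw [hψ, show θ₀ g = -1 from signCharOfIndexTwo_apply_of_not_mem hH2 hg,
        Matrix.GeneralLinearGroup.coe_one, Matrix.one_apply_eq, Units.val_neg, Units.val_one] at h1
      norm_num at h1
    · intro hg
      ext i j
      rw [hψ, show θ₀ g = 1 from signCharOfIndexTwo_apply_of_mem hH2 hg, Units.val_one,
        Matrix.GeneralLinearGroup.coe_one, Subsingleton.elim i j, Matrix.one_apply_eq]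
  have hker : IsOpen (ψ.toMonoidHom.ker : Set (absoluteGaloisGroup K)) := by
    have : (ψ.toMonoidHom.ker : Set (absoluteGaloisGroup K)) = H := by
      ext g
      exact hψ1 g
    rw [this]
    exact hHo
  have hunrψ : ∀ᶠ v in cofinite, ψ.IsUnramifiedAt v :=
    ψ.eventually_isUnramifiedAt_of_isOpen_ker hker
  have hunrL : ∀ᶠ v : HeightOneSpectrum (𝓞 K) in cofinite, Algebra.IsUnramifiedIn (𝓞 L) v.asIdeal := by
    rw [eventually_cofinite]
    exact finite_setOf_not_isUnramifiedIn K L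
  refine ⟨L, inferInstance, inferInstance, inferInstance, h2, ?_⟩
  filter_upwards [hunrψ, hunrL] with v hψv hvL
  intro 𝔓 h𝔓 Φ hΦ
  constructor
  · -- split: every place above `v` has residue degree `1`
    intro hΦH
    have hΦr : Φ ∈ r.range := (hrange Φ).mpr hΦH
    obtain ⟨c, hc⟩ : ∃ c, c ∉ r.range := by
      by_contra! hall
      have : r.range = ⊤ := eq_top_iff.mpr fun g _ => hall g
      rw [this, Subgroup.index_top, h2] at hHi
      exact absurd hHi (by norm_num)
    obtain ⟨P, 𝔔, τ, hP, hf1, -, -⟩ :=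
      exists_places_split_of_mem_range (F := K) (M := L) hprime hrn hHi hc hvL h𝔓 hΦ hΦr
    exact ⟨P 0, congrArg HeightOneSpectrum.asIdeal (hP 0).1, hf1 _ (hP 0).1⟩
  · -- inert: one place above `v`, of residue degree `2`
    rintro ⟨w', hw', hf'⟩
    by_contra hΦH
    have hΦr : Φ ∉ r.range := fun h => hΦH ((hrange Φ).mp h)
    have hI : 𝔓.inertia (absoluteGaloisGroup K) ≤ r.range := fun g hg =>
      (hrange g).mpr ((hψ1 g).mp (hψv 𝔓 h𝔓 g hg))
    obtain ⟨w, -, -, -, huniq, hfw, -⟩ :=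
      exists_place_inert_of_not_mem_range (F := K) (M := L) hprime hrn hHi hvL h𝔓 hI hΦ hΦr
    have hw'v : w'.under (𝓞 K) = v := HeightOneSpectrum.ext hw'
    have := huniq w' hw'v
    subst this
    rw [hfw, h2] at hf'
    exact absurd hf' (by norm_num)

/-- `1(ϖ_v) = 1`. -/
theorem valueAtUniformizer_one (v : HeightOneSpectrum (𝓞 ℚ)) :
    (1 : HeckeCharacter ℚ).valueAtUniformizer v = 1 := by
  simp only [HeckeCharacter.valueAtUniformizer, HeckeCharacter.localComponent_apply,
    HeckeCharacter.one_apply, Units.val_one]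

/-- **The Hecke character of an open subgroup of index `≤ 2`**: a finite-order Hecke character `ω`
of `ℚ` with `ω(ϖ_v) = ±1` according as the Frobenius at `v` lies in `H` or not, for almost all `v`
(`ω = 1` if `H = Γ_ℚ`; otherwise the quadratic character of `ℚ̄^H`, through
`exists_quadratic_frob_mem_iff` and `exists_heckeCharacter_quadraticSign_of_finrank_eq_two`). -/
theorem exists_heckeCharacter_of_index_le_two (H : Subgroup (absoluteGaloisGroup ℚ))
    (hHo : IsOpen (H : Set (absoluteGaloisGroup ℚ))) (hidx : H.index = 1 ∨ H.index = 2) :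
    ∃ ω : HeckeCharacter ℚ, ω.IsFiniteOrder ∧ ∀ᶠ v : HeightOneSpectrum (𝓞 ℚ) in cofinite,
      ∀ 𝔓 ∈ v.primesAbove, ∀ Φ : absoluteGaloisGroup ℚ, IsArithFrobAt (𝓞 ℚ) Φ 𝔓 →
        ω.valueAtUniformizer v = if Φ ∈ H then 1 else -1 := by
  classical
  rcases hidx with h1 | h2
  · refine ⟨1, IsOfFinOrder.one, Eventually.of_forall fun v 𝔓 _ Φ _ => ?_⟩
    rw [Subgroup.index_eq_one.1 h1, if_pos (Subgroup.mem_top Φ)]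
    exact valueAtUniformizer_one v
  · obtain ⟨L, _, _, _, hL2, hL⟩ := exists_quadratic_frob_mem_iff ℚ H hHo h2
    obtain ⟨ω, hfin, hω⟩ := exists_heckeCharacter_quadraticSign_of_finrank_eq_two (F := ℚ) (E := L) hL2
    refine ⟨ω, hfin, ?_⟩
    filter_upwards [hL, hω] with v hv hωv
    intro 𝔓 h𝔓 Φ hΦ
    rw [hωv.2, quadraticSign]
    by_cases hmem : Φ ∈ H
    · rw [if_pos ((hv 𝔓 h𝔓 Φ hΦ).1 hmem), if_pos hmem]
    · rw [if_neg (fun h => hmem ((hv 𝔓 h𝔓 Φ hΦ).2 h)), if_neg hmem]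

end Omega

end Summit.Langlands.Langlands.Theorems.ResidualAutomorphyOdd
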